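import Summits.AtomisticToContinuum.Crystallization.Theorems.FrustratedLawDichotomyStrainedPatchHomValueT2KitL
import Summits.AtomisticToContinuum.Crystallization.Theorems.FrustratedLawDichotomyStrainedPatchHomValueT2SoundD

/-!
# (I1) part O — SYMMETRIC REGROUPING of double and triple index sums (roadmap for `valueLeafT2J_sound`, step 3a): the kit's Lipschitz pass
# (`…HomValueT2KitL.accLabel`) visits each index MULTISET `a ≤ b ≤ m` once with the multiplicity weight `wSym`; the real cubic remainder
# `Σ_{k,l,m} T_klm δ_k δ_l δ_m` is an ORDERED sum of a symmetric summand.  This file proves the regrouping identities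
# ★ `sum_pair_regroup`: `Σ_{k,l<n} F k l = Σ_{a≤b<n} (1 ∣ 2)·F a b` and ★★ `sum_triple_regroup`: `Σ_{k,l,m<n} G k l m = Σ_{a≤b≤m<n} (1 ∣ 3 ∣ 6)·G a b m`
# for symmetric `F`, `G` (any `n`, induction on `n`), and ★ identifies the multiplicity with the kit's `wSym wJ` on sorted triples below `9`
# (27623 `(H) HomFloor`, hcp half; decomp-a2c hand-1 g49; critic row 1674 (B) (I1) docket).

No definitions; 0 sorry; standard axioms; no instances / notation / `#eval`.  `--supports stmt-AtomisticToContinuum-27623`.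
-/

namespace Summit.AtomisticToContinuum.Crystallization.Theorems.FrustratedLawDichotomyStrainedPatchHomValueT2Kit

open scoped BigOperators
open Finset

/-! ## §1. Pairs -/

/-- ★ **PAIR REGROUPING**: for a symmetric `F`, `Σ_{k<n} Σ_{l<n} F k l = Σ_{a<n} Σ_{b<n} [a ≤ b]·(1 if a = b else 2)·F a b`. [folklore: induction on `n`] -/
theorem sum_pair_regroup {R : Type*} [CommRing R] (F : ℕ → ℕ → R) (hF : ∀ k l, F k l = F l k) (n : ℕ) :
    ∑ k ∈ range n, ∑ l ∈ range n, F k l = ∑ a ∈ range n, ∑ b ∈ range n, (if a ≤ b then (if a = b then (1 : R) else 2) * F a b else 0) := by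
  induction n with
  | zero => simp
  | succ n ih =>
    -- the new row/column terms
    have hrow : ∑ l ∈ range n, F n l = ∑ k ∈ range n, F k n := Finset.sum_congr rfl fun k _ => hF n k
    have hcol0 : ∑ b ∈ range n, (if n ≤ b then (if n = b then (1 : R) else 2) * F n b else 0) = 0 :=
      Finset.sum_eq_zero fun b hb => by rw [if_neg (by have := Finset.mem_range.1 hb; omega)]
    have hcol2 : ∑ a ∈ range n, (if a ≤ n then (if a = n then (1 : R) else 2) * F a n else 0) = 2 * ∑ a ∈ range n, F a n := by
      rw [Finset.mul_sum]
      exact Finset.sum_congr rfl fun a ha => by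
        have := Finset.mem_range.1 ha
        rw [if_pos (by omega), if_neg (by omega)]
    -- peel the last index on both sides
    simp only [Finset.sum_range_succ, Finset.sum_add_distrib, le_refl, if_true]
    rw [ih, hrow, hcol0, hcol2]
    ring

/-! ## §2. Triples -/

/-- ★★ **TRIPLE REGROUPING**: for a symmetric `G` (in the first two and in the last two arguments),
`Σ_{k,l,m<n} G k l m = Σ_{a,b,m<n} [a ≤ b ≤ m]·μ(a,b,m)·G a b m` with the multiplicity `μ = 1` (`a = b = m`), `3` (exactly two equal), `6` (all distinct).
[folklore: induction on `n`, the new layer regrouped by `sum_pair_regroup`] -/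
theorem sum_triple_regroup {R : Type*} [CommRing R] (G : ℕ → ℕ → ℕ → R) (h12 : ∀ k l m, G k l m = G l k m) (h23 : ∀ k l m, G k l m = G k m l)
    (n : ℕ) :
    ∑ k ∈ range n, ∑ l ∈ range n, ∑ m ∈ range n, G k l m =
      ∑ a ∈ range n, ∑ b ∈ range n, ∑ m ∈ range n,
        (if a ≤ b ∧ b ≤ m then (if a = b then (if b = m then (1 : R) else 3) else (if b = m then 3 else 6)) * G a b m else 0) := by
  have h13 : ∀ k l m, G k l m = G m l k := fun k l m => by rw [h12, h23, h12]
  induction n with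
  | zero => simp
  | succ n ih =>
    -- LHS: split every index at `n`
    have eL : ∑ k ∈ range (n + 1), ∑ l ∈ range (n + 1), ∑ m ∈ range (n + 1), G k l m =
        (∑ k ∈ range n, ∑ l ∈ range n, ∑ m ∈ range n, G k l m) + 3 * ∑ k ∈ range n, ∑ l ∈ range n, G k l n +
          3 * ∑ k ∈ range n, G k n n + G n n n := by
      simp only [Finset.sum_range_succ, Finset.sum_add_distrib]
      have e1 : ∑ k ∈ range n, ∑ l ∈ range n, G k n l = ∑ k ∈ range n, ∑ l ∈ range n, G k l n :=
        Finset.sum_congr rfl fun k _ => Finset.sum_congr rfl fun l _ => h23 k n l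
      have e2 : ∑ l ∈ range n, ∑ m ∈ range n, G n l m = ∑ k ∈ range n, ∑ l ∈ range n, G k l n :=
        Finset.sum_congr rfl fun k _ => Finset.sum_congr rfl fun l _ => by rw [h13, h12]
      have e3 : ∑ k ∈ range n, G k n n = ∑ k ∈ range n, G k n n := rfl
      have e4 : ∑ l ∈ range n, G n l n = ∑ k ∈ range n, G k n n := Finset.sum_congr rfl fun k _ => by rw [h12]
      have e5 : ∑ m ∈ range n, G n n m = ∑ k ∈ range n, G k n n := Finset.sum_congr rfl fun k _ => by rw [h13]
      rw [e1, e2, e4, e5]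
      ring
    -- RHS: the same split; the indicator kills every new term with `n` not in the last sorted positions
    set W : ℕ → ℕ → ℕ → R := fun a b m =>
      if a ≤ b ∧ b ≤ m then (if a = b then (if b = m then (1 : R) else 3) else (if b = m then 3 else 6)) * G a b m else 0 with hW
    have eR : ∑ a ∈ range (n + 1), ∑ b ∈ range (n + 1), ∑ m ∈ range (n + 1), W a b m =
        (∑ a ∈ range n, ∑ b ∈ range n, ∑ m ∈ range n, W a b m) +
          ∑ a ∈ range n, ∑ b ∈ range n, (if a ≤ b then (if a = b then (3 : R) else 6) * G a b n else 0) +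
          3 * ∑ a ∈ range n, G a n n + G n n n := by
      simp only [Finset.sum_range_succ, Finset.sum_add_distrib]
      -- classify the seven kinds of new terms
      have z1 : ∑ a ∈ range n, ∑ b ∈ range n, W a n b = 0 := Finset.sum_eq_zero fun a _ => Finset.sum_eq_zero fun b hb => by
        have := Finset.mem_range.1 hb; simp only [hW]; rw [if_neg (by omega)]
      have z2 : ∑ b ∈ range n, ∑ m ∈ range n, W n b m = 0 := Finset.sum_eq_zero fun b hb => Finset.sum_eq_zero fun m _ => by
        have := Finset.mem_range.1 hb; simp only [hW]; rw [if_neg (by omega)]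
      have z3 : ∑ b ∈ range n, W n b n = 0 := Finset.sum_eq_zero fun b hb => by
        have := Finset.mem_range.1 hb; simp only [hW]; rw [if_neg (by omega)]
      have z4 : ∑ m ∈ range n, W n n m = 0 := Finset.sum_eq_zero fun m hm => by
        have := Finset.mem_range.1 hm; simp only [hW]; rw [if_neg (by omega)]
      have t1 : ∑ a ∈ range n, ∑ b ∈ range n, W a b n = ∑ a ∈ range n, ∑ b ∈ range n, (if a ≤ b then (if a = b then (3 : R) else 6) * G a b n else 0) :=
        Finset.sum_congr rfl fun a ha => Finset.sum_congr rfl fun b hb => by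
          have ha' := Finset.mem_range.1 ha
          have hb' := Finset.mem_range.1 hb
          simp only [hW]
          by_cases hab : a ≤ b
          · rw [if_pos ⟨hab, by omega⟩, if_pos hab]
            by_cases heq : a = b
            · rw [if_pos heq, if_pos heq, if_neg (by omega)]
            · rw [if_neg heq, if_neg heq, if_neg (by omega)]
          · rw [if_neg (fun h => hab h.1), if_neg hab]
      have t2 : ∑ a ∈ range n, W a n n = 3 * ∑ a ∈ range n, G a n n := by
        rw [Finset.mul_sum]
        refine Finset.sum_congr rfl fun a ha => ?_
        have := Finset.mem_range.1 ha
        simp only [hW]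
        rw [if_pos ⟨by omega, le_rfl⟩, if_neg (by omega)]
        simp
      have t3 : W n n n = G n n n := by simp [hW]
      rw [z1, z2, z3, z4, t1, t2, t3]
      ring
    rw [eL, eR, ih, sum_pair_regroup (fun k l => G k l n) (fun k l => h12 k l n) n]
    have e : 3 * (∑ a ∈ range n, ∑ b ∈ range n, (if a ≤ b then (if a = b then (1 : R) else 2) * G a b n else 0)) =
        ∑ a ∈ range n, ∑ b ∈ range n, (if a ≤ b then (if a = b then (3 : R) else 6) * G a b n else 0) := by
      rw [Finset.mul_sum]
      refine Finset.sum_congr rfl fun a _ => ?_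
      rw [Finset.mul_sum]
      refine Finset.sum_congr rfl fun b _ => ?_
      split_ifs <;> ring
    rw [← e]

/-! ## §3. The kit's multiplicity weight on sorted triples -/

/-- ★ On sorted triples below `9` the kit's `wSym wJ` is the multiplicity `1 ∣ 3 ∣ 6`. [formal bookkeeping: finite check] -/
theorem wSym_wJ_eq {a b m : ℕ} (ha : a < 9) (hb : b < 9) (hm : m < 9) (hab : a ≤ b) (hbm : b ≤ m) :
    wSym wJ a b m = (if a = b then (if b = m then 1 else 3) else (if b = m then 3 else 6)) := by
  have key : ∀ a b m : Fin 9, (a : ℕ) ≤ b → (b : ℕ) ≤ m →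
      wSym wJ a b m = (if (a : ℕ) = b then (if (b : ℕ) = m then 1 else 3) else (if (b : ℕ) = m then 3 else 6)) := by
    decide
  exact key ⟨a, ha⟩ ⟨b, hb⟩ ⟨m, hm⟩ hab hbm

end Summit.AtomisticToContinuum.Crystallization.Theorems.FrustratedLawDichotomyStrainedPatchHomValueT2Kit
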